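import Summits.QuantumFields.YangMills.Theorems.IR.AfPincerUcXCovFemtoSharp

/-!
# Crux `IR` (stmt-QuantumFields-19354), line `af-pincer`, X-side (lane (1)A): the femto conditional package FROM the currency of line
# `dlr-collar-transfer` — `FBL ⇒ CondOscAt`, «`FC2`-upper with AF decay `Γ(0⁺) = 0`» ⇒ `CondCovAFAt`, monotonicity in collar and range

Fifth file of `Theorems/IR/AfPincerUcXCovFemto*` (seat ym-19354-afpincer-s2, generation 3).  `…XCovFemtoSharp` named the X-desk's femto asks
`Femto.CondOscAt G r u κ ℓ C₁` (E1-osc, collar form), `Femto.CondCovAFAt G r u κ ℓ` (conditional AF of the two-point amplitude) and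
`Femto.FemtoAFAt G r u`, and proved `FemtoAFAt G r u → SharpLanes.CovWindowAt G r (1/u)`.  THIS FILE kernel-checks the currency match
asserted there in prose, so that the UV desk may deliver the X-side input in the SHAPES the line `dlr-collar-transfer`
(`Theorems/LangevinControlUVOSLegsFromFemtoAndGapDefs`: `FBL`, `FC2`; registered `Statement.stub_fcp`) already posits:

* §1 monotonicity: `CondOscAt` / `CondCovAFAt` are MONOTONE in the collar `κ` (a deeper collar asks less) and ANTITONE in the femto range `ℓ`
  (a shorter range asks less);
* §2 **`condOscAt_of_fbl`**: `DlrCollarTransfer.FBL G r u` (the femto boundary law, EVERY exterior, depth `≥ 2`) and `u β ≤ κ/2` eventually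
  ⇒ `CondOscAt G r u κ ℓ₁ (2C₁)` for FBL's own range `ℓ₁` — for EVERY collar `κ > 0`;
* §3 **`condCovAFAt_of_fc2Upper`**: the UPPER half of `FC2`'s two-point clause with an EXPLICIT shape function `Γ` and scale-indexed collar `K`
  («`‖y−x‖⁸ |kerCov^η(A_x,A_y)| ≤ C₂ Γ(‖y−x‖·uβ)` at lattice depth `≥ K(s₀)‖y−x‖`, `0 < s₀ ≤ ‖y−x‖·uβ`, `‖y−x‖ ≥ n₀`, on femto cubes `b·uβ ≤ ℓ₂`»),
  together with `s K(s) → 0` (FC2's clause) and the ASYMPTOTIC-FREEDOM decay `Γ(s) → 0` as `s → 0⁺` (NOT a clause of `FC2`: its `Γ` is only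
  continuous, `0 < Γ ≤ 1`, `Γ(s)/s⁸ → ∞`) ⇒ `CondCovAFAt G r u κ ℓ₂` for EVERY collar `κ > 0` (take `s₀ = ‖y−x‖·uβ` once `s K(s) ≤ κ`);
* §4 **`femtoAFAt_of_fbl_fc2UpperAF`**: hence `FBL G r u` ∧ «FC2-upper with AF decay» ∧ `u → 0` ⇒ `FemtoAFAt G r u` (collar `κ = min ℓ₁ ℓ₂ / 4`),
  and so `SharpLanes.CovWindowAt G r (1/u)` (`covWindowAt_of_fbl_fc2UpperAF`).

HONEST FRAMING.  Implications among OPEN statements (FBL, FC2-upper-with-AF are UV-engine statements nobody has proved for 4-d SU(N); FBL's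
exterior-uniform form is under numerical attack by `ym-cdisprove-19353-penetration`, whence the tempered twin `…XCovFemtoTempered`); nothing here
proves asymptotic freedom, mixing or a gap; one open gap-crux of a CONDITIONAL chain (Track A 0/28 UV); not Clay.  No `sorry`;
axioms ⊆ {propext, Classical.choice, Quot.sound}.
-/

set_option autoImplicit false

noncomputable section

open Filter Topology Finset MeasureTheory
open scoped BigOperators SchwartzMap
open Literature.MathematicalPhysics.QuantumFieldTheory hiding ZdEdge
open Literature.MathematicalPhysics.QuantumLattice
open Literature.Probability.LatticeModels (Site box mem_box)
open Summit.QuantumFields.YangMills.Cruxes.OSLegsFromFemtoAndGap.DlrCollarTransfer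

namespace Summit.QuantumFields.YangMills.Cruxes.IR.AfPincerUc.Femto

open Summit.QuantumFields.YangMills.Cruxes.IR.AfPincerUc
open Summit.QuantumFields.YangMills.Cruxes.IR.AfPincerUc.SharpLanes

variable {G : Type} [Group G] [TopologicalSpace G] [IsTopologicalGroup G] [CompactSpace G]
  [MeasurableSpace G] [BorelSpace G]

/-! ## §1 Monotonicity in the collar and in the femto range -/
section Mono

/-- `CondOscAt` is MONOTONE in the collar: a deeper collar `κ′ ≥ κ` asks the oscillation bound at fewer sites. [arithmetic] -/
theorem condOscAt_mono_collar (r : LatticeRep G) {u : ℝ → ℝ} (hu : ∀ β, 0 < u β) {κ κ' ℓ C₁ : ℝ} (hκ : κ ≤ κ')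
    (h : CondOscAt G r u κ ℓ C₁) : CondOscAt G r u κ' ℓ C₁ := by
  obtain ⟨β₁, hβ⟩ := h
  refine ⟨β₁, fun β hb c b hfem η η' x hx => hβ β hb c b hfem η η' x ?_⟩
  exact le_trans (div_le_div_of_nonneg_right hκ (hu β).le) hx

/-- `CondOscAt` is ANTITONE in the femto range: a shorter range `ℓ′ ≤ ℓ` asks the bound on fewer cubes. [arithmetic] -/
theorem condOscAt_anti_range (r : LatticeRep G) {u : ℝ → ℝ} {κ ℓ ℓ' C₁ : ℝ} (hℓ : ℓ' ≤ ℓ)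
    (h : CondOscAt G r u κ ℓ C₁) : CondOscAt G r u κ ℓ' C₁ := by
  obtain ⟨β₁, hβ⟩ := h
  exact ⟨β₁, fun β hb c b hfem η η' x hx => hβ β hb c b (hfem.trans hℓ) η η' x hx⟩

/-- `CondCovAFAt` is MONOTONE in the collar. [arithmetic] -/
theorem condCovAFAt_mono_collar (r : LatticeRep G) {u : ℝ → ℝ} (hu : ∀ β, 0 < u β) {κ κ' ℓ : ℝ} (hκ : κ ≤ κ')
    (h : CondCovAFAt G r u κ ℓ) : CondCovAFAt G r u κ' ℓ := by
  obtain ⟨n₀, hW⟩ := h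
  refine ⟨n₀, fun W' hW' => ?_⟩
  obtain ⟨s', β', hs', hβ⟩ := hW W' hW'
  refine ⟨s', β', hs', fun β hb c b hfem η x y hn hx hy hsep => hβ β hb c b hfem η x y hn ?_ ?_ hsep⟩
  · exact le_trans (div_le_div_of_nonneg_right hκ (hu β).le) hx
  · exact le_trans (div_le_div_of_nonneg_right hκ (hu β).le) hy

/-- `CondCovAFAt` is ANTITONE in the femto range. [arithmetic] -/
theorem condCovAFAt_anti_range (r : LatticeRep G) {u : ℝ → ℝ} {κ ℓ ℓ' : ℝ} (hℓ : ℓ' ≤ ℓ)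
    (h : CondCovAFAt G r u κ ℓ) : CondCovAFAt G r u κ ℓ' := by
  obtain ⟨n₀, hW⟩ := h
  refine ⟨n₀, fun W' hW' => ?_⟩
  obtain ⟨s', β', hs', hβ⟩ := hW W' hW'
  exact ⟨s', β', hs', fun β hb c b hfem η x y hn hx hy hsep => hβ β hb c b (hfem.trans hℓ) η x y hn hx hy hsep⟩

end Mono

/-! ## §2 `FBL ⇒ CondOscAt` -/
section FromFBL

/-- **The femto boundary law (body form) gives E1-osc in collar form (PROVED).**  Kernel means of the action density within `C₁/depth⁴` of a
reference value `p β` for EVERY exterior at depth `≥ 2` on femto cubes `b·uβ ≤ ℓ₁` (the body of `FBL G r u` for `β ≥ β₁`), and `u β ≤ κ/2` for all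
large `β` (so that physical depth `≥ κ` means lattice depth `≥ 2`), give `CondOscAt G r u κ ℓ₁ (2C₁)`. [kernel implication; FBL OPEN] -/
theorem condOscAt_of_fblBody (r : LatticeRep G) {u : ℝ → ℝ} (hu : ∀ β, 0 < u β) {C₁ β₁ ℓ₁ : ℝ} {p : ℝ → ℝ}
    (hF : ∀ β : ℝ, β₁ ≤ β → ∀ (c : Fin 4 → ℤ) (b : ℕ), (b : ℝ) * u β ≤ ℓ₁ → ∀ (η : LGConfig 4 G) (x : Fin 4 → ℤ),
      2 ≤ depth c b x → |kerE G r β c b η (dens G r x) - p β| ≤ C₁ / (depth c b x : ℝ) ^ 4)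
    {κ : ℝ} (hsmall : ∃ βu : ℝ, ∀ β : ℝ, βu ≤ β → u β ≤ κ / 2) : CondOscAt G r u κ ℓ₁ (2 * C₁) := by
  obtain ⟨βu, hβu⟩ := hsmall
  refine ⟨max β₁ βu, fun β hβ c b hfem η η' x hx => ?_⟩
  have hβ₁ : β₁ ≤ β := le_trans (le_max_left _ _) hβ
  have hβu' : βu ≤ β := le_trans (le_max_right _ _) hβ
  have huβ := hu β
  -- lattice depth `≥ 2` from physical depth `≥ κ` and `u β ≤ κ/2`
  have h2 : (2 : ℝ) ≤ κ / u β := by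
    rw [le_div_iff₀ huβ]
    have := hβu β hβu'
    linarith
  have hd2 : 2 ≤ depth c b x := by
    have : (2 : ℝ) ≤ (depth c b x : ℝ) := h2.trans hx
    exact_mod_cast this
  have hx' := hF β hβ₁ c b hfem η x hd2
  have hy' := hF β hβ₁ c b hfem η' x hd2
  have tri := abs_sub_le (kerE G r β c b η (dens G r x)) (p β) (kerE G r β c b η' (dens G r x))
  rw [abs_sub_comm (p β)] at tri
  have e : 2 * C₁ / (depth c b x : ℝ) ^ 4 = C₁ / (depth c b x : ℝ) ^ 4 + C₁ / (depth c b x : ℝ) ^ 4 := by ring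
  rw [e]
  linarith

/-- **`FBL G r u` BY NAME gives E1-osc in collar form for EVERY collar `κ > 0` (PROVED)**, with FBL's own range and twice its constant,
provided `u β ≤ κ/2` eventually (e.g. `u → 0`). [kernel implication; FBL OPEN] -/
theorem condOscAt_of_fbl (r : LatticeRep G) {u : ℝ → ℝ} (hu : ∀ β, 0 < u β) (hFBL : FBL G r u) {κ : ℝ}
    (hsmall : ∃ βu : ℝ, ∀ β : ℝ, βu ≤ β → u β ≤ κ / 2) :
    ∃ ℓ₁ C : ℝ, 0 < ℓ₁ ∧ 0 ≤ C ∧ CondOscAt G r u κ ℓ₁ C := by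
  obtain ⟨C₁, β₁, ℓ₁, p, hℓ₁, hC₁, hF⟩ := hFBL
  exact ⟨ℓ₁, 2 * C₁, hℓ₁, by positivity, condOscAt_of_fblBody r hu hF hsmall⟩

end FromFBL

/-! ## §3 «FC2-upper with AF decay» ⇒ `CondCovAFAt` -/
section FromFC2

/-- **The upper half of `FC2`'s two-point clause, with explicit shape `Γ` tending to `0` at `0⁺`, gives CondCovAF in collar form (PROVED).**
Hypotheses: a scale-indexed collar `K ≥ 1` with `s K(s) → 0` (as in `FC2`), a shape `Γ` with `Γ(s) → 0` as `s → 0⁺` (ASYMPTOTIC FREEDOM — NOT a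
clause of `FC2`), `C₂ ≥ 0`, and for `β ≥ β₂` on femto cubes `b·uβ ≤ ℓ₂`, every exterior, every pair with `0 < s₀ ≤ ‖y−x‖·uβ`, `‖y−x‖ ≥ n₀` and
lattice depths `≥ K(s₀)·‖y−x‖`: `‖y−x‖⁸ |kerCov^η(A_x,A_y)| ≤ C₂ Γ(‖y−x‖·uβ)`.  Conclusion: `CondCovAFAt G r u κ ℓ₂` for every collar `κ > 0`
(at physical separation `σ ≤ s′` with `σ K(σ) ≤ κ`, the collar `K(σ)‖y−x‖ = σK(σ)/uβ ≤ κ/uβ` fits). [kernel implication; hypotheses OPEN] -/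
theorem condCovAFAt_of_fc2Upper (r : LatticeRep G) {u : ℝ → ℝ} (hu : ∀ β, 0 < u β) {Γ K : ℝ → ℝ} {β₂ ℓ₂ C₂ : ℝ} {n₀ : ℕ}
    (hC₂ : 0 ≤ C₂) (hKlim : Tendsto (fun s : ℝ => s * K s) (nhdsWithin 0 (Set.Ioi 0)) (nhds 0))
    (hΓ : Tendsto Γ (nhdsWithin 0 (Set.Ioi 0)) (nhds 0))
    (hFC2U : ∀ β : ℝ, β₂ ≤ β → ∀ (c : Fin 4 → ℤ) (b : ℕ), (b : ℝ) * u β ≤ ℓ₂ →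
      ∀ (η : LGConfig 4 G) (x y : Fin 4 → ℤ) (s₀ : ℝ), 0 < s₀ → s₀ ≤ ‖siteToE (y - x)‖ * u β →
        (n₀ : ℝ) ≤ ‖siteToE (y - x)‖ → K s₀ * ‖siteToE (y - x)‖ ≤ (depth c b x : ℝ) → K s₀ * ‖siteToE (y - x)‖ ≤ (depth c b y : ℝ) →
          ‖siteToE (y - x)‖ ^ 8 * |kerCov G r β c b η (dens G r x) (dens G r y)| ≤ C₂ * Γ (‖siteToE (y - x)‖ * u β))
    {κ : ℝ} (hκ : 0 < κ) : CondCovAFAt G r u κ ℓ₂ := by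
  refine ⟨max n₀ 1, fun W' hW' => ?_⟩
  -- `Γ` small and `s K(s) ≤ κ` on `(0, s₁)`
  have hev : ∀ᶠ s in nhdsWithin (0 : ℝ) (Set.Ioi 0), Γ s < W' / (C₂ + 1) ∧ s * K s < κ := by
    have h1 : ∀ᶠ s in nhdsWithin (0 : ℝ) (Set.Ioi 0), Γ s < W' / (C₂ + 1) :=
      hΓ (Iio_mem_nhds (by positivity))
    have h2 : ∀ᶠ s in nhdsWithin (0 : ℝ) (Set.Ioi 0), s * K s < κ := hKlim (Iio_mem_nhds hκ)
    exact h1.and h2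
  obtain ⟨s₁, hs₁, hball⟩ : ∃ s₁ > 0, ∀ s : ℝ, 0 < s → s < s₁ → Γ s < W' / (C₂ + 1) ∧ s * K s < κ := by
    rw [eventually_nhdsWithin_iff, Metric.eventually_nhds_iff] at hev
    obtain ⟨ε, hε, hεs⟩ := hev
    refine ⟨ε, hε, fun s hs0 hsε => hεs ?_ (Set.mem_Ioi.2 hs0)⟩
    rw [Real.dist_eq, sub_zero, abs_of_pos hs0]
    exact hsε
  refine ⟨s₁ / 2, β₂, by positivity, fun β hβ c b hfem η x y hn hx hy hsep => ?_⟩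
  have huβ := hu β
  set E : ℝ := ‖siteToE (y - x)‖ with hE
  have hn₀ : (n₀ : ℝ) ≤ E := le_trans (by exact_mod_cast le_max_left n₀ 1) hn
  have hE1 : (1 : ℝ) ≤ E := le_trans (by exact_mod_cast le_max_right n₀ 1) hn
  have hE0 : 0 < E := lt_of_lt_of_le one_pos hE1
  set σ : ℝ := E * u β with hσ
  have hσ0 : 0 < σ := mul_pos hE0 huβ
  have hσ1 : σ < s₁ := lt_of_le_of_lt hsep (by linarith)
  obtain ⟨hΓσ, hKσ⟩ := hball σ hσ0 hσ1
  -- the collar `K(σ) E = σ K(σ) / uβ ≤ κ / uβ ≤ depth`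
  have hcollar : K σ * E ≤ κ / u β := by
    rw [le_div_iff₀ huβ]
    calc K σ * E * u β = σ * K σ := by rw [hσ]; ring
      _ ≤ κ := hKσ.le
  have h := hFC2U β hβ c b hfem η x y σ hσ0 le_rfl hn₀ (hcollar.trans hx) (hcollar.trans hy)
  refine h.trans ?_
  have hC1 : C₂ * Γ σ ≤ C₂ * (W' / (C₂ + 1)) := mul_le_mul_of_nonneg_left hΓσ.le hC₂
  have hC3 : C₂ * (W' / (C₂ + 1)) ≤ W' := by
    rw [mul_div_assoc', div_le_iff₀ (by positivity)]
    nlinarith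
  exact hC1.trans hC3

end FromFC2

/-! ## §4 The package and the window from `FBL` ∧ «FC2-upper with AF decay» -/
section Package

/-- **`FBL` ∧ «FC2-upper with AF decay» ∧ `u → 0` ⇒ the femto conditional AF package `FemtoAFAt G r u` (PROVED).**  The collar is
`κ = min ℓ₁ ℓ₂ / 4` and the range `min ℓ₁ ℓ₂` (§1 monotonicity). [kernel implication; hypotheses OPEN] -/
theorem femtoAFAt_of_fbl_fc2UpperAF (r : LatticeRep G) {u : ℝ → ℝ} (hu : ∀ β, 0 < u β) (hu0 : Tendsto u atTop (𝓝 0))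
    (hFBL : FBL G r u) {Γ K : ℝ → ℝ} {β₂ ℓ₂ C₂ : ℝ} {n₀ : ℕ} (hℓ₂ : 0 < ℓ₂) (hC₂ : 0 ≤ C₂)
    (hKlim : Tendsto (fun s : ℝ => s * K s) (nhdsWithin 0 (Set.Ioi 0)) (nhds 0))
    (hΓ : Tendsto Γ (nhdsWithin 0 (Set.Ioi 0)) (nhds 0))
    (hFC2U : ∀ β : ℝ, β₂ ≤ β → ∀ (c : Fin 4 → ℤ) (b : ℕ), (b : ℝ) * u β ≤ ℓ₂ →
      ∀ (η : LGConfig 4 G) (x y : Fin 4 → ℤ) (s₀ : ℝ), 0 < s₀ → s₀ ≤ ‖siteToE (y - x)‖ * u β →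
        (n₀ : ℝ) ≤ ‖siteToE (y - x)‖ → K s₀ * ‖siteToE (y - x)‖ ≤ (depth c b x : ℝ) → K s₀ * ‖siteToE (y - x)‖ ≤ (depth c b y : ℝ) →
          ‖siteToE (y - x)‖ ^ 8 * |kerCov G r β c b η (dens G r x) (dens G r y)| ≤ C₂ * Γ (‖siteToE (y - x)‖ * u β)) :
    FemtoAFAt G r u := by
  -- FBL's range `ℓ₁`; the collar `κ = min ℓ₁ ℓ₂ / 4`
  obtain ⟨C₁, β₁, ℓ₁, p, hℓ₁, hC₁, hF⟩ := hFBL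
  set ℓ : ℝ := min ℓ₁ ℓ₂ with hℓ
  have hℓ0 : 0 < ℓ := lt_min hℓ₁ hℓ₂
  set κ : ℝ := ℓ / 4 with hκdef
  have hκ : 0 < κ := by positivity
  have hκℓ : 2 * κ < ℓ := by rw [hκdef]; linarith
  -- `u β ≤ κ/2` eventually
  have hsmall : ∃ βu : ℝ, ∀ β : ℝ, βu ≤ β → u β ≤ κ / 2 := by
    have hev : ∀ᶠ β in atTop, u β ≤ κ / 2 := (hu0.eventually (Iic_mem_nhds (by positivity))).mono fun β h => h
    obtain ⟨βu, hβu⟩ := hev.exists_forall_of_atTop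
    exact ⟨βu, hβu⟩
  have hosc₁ : CondOscAt G r u κ ℓ₁ (2 * C₁) := condOscAt_of_fblBody r hu hF hsmall
  have hcov : CondCovAFAt G r u κ ℓ₂ := condCovAFAt_of_fc2Upper r hu hC₂ hKlim hΓ hFC2U hκ
  exact ⟨κ, ℓ, 2 * C₁, hκ, hκℓ, by positivity, condOscAt_anti_range r (min_le_left _ _) hosc₁,
    condCovAFAt_anti_range r (min_le_right _ _) hcov⟩

/-- **… hence the asymptotic-freedom WINDOW `SharpLanes.CovWindowAt G r (1/u)` from `FBL G r u` ∧ «FC2-upper with AF decay» ∧ `u → 0`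
(PROVED composition).**  The X-side input of lane (1)A in the shapes of line `dlr-collar-transfer`. [hypotheses OPEN] -/
theorem covWindowAt_of_fbl_fc2UpperAF (r : LatticeRep G) {u : ℝ → ℝ} (hu : ∀ β, 0 < u β) (hu0 : Tendsto u atTop (𝓝 0))
    (hFBL : FBL G r u) {Γ K : ℝ → ℝ} {β₂ ℓ₂ C₂ : ℝ} {n₀ : ℕ} (hℓ₂ : 0 < ℓ₂) (hC₂ : 0 ≤ C₂)
    (hKlim : Tendsto (fun s : ℝ => s * K s) (nhdsWithin 0 (Set.Ioi 0)) (nhds 0))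
    (hΓ : Tendsto Γ (nhdsWithin 0 (Set.Ioi 0)) (nhds 0))
    (hFC2U : ∀ β : ℝ, β₂ ≤ β → ∀ (c : Fin 4 → ℤ) (b : ℕ), (b : ℝ) * u β ≤ ℓ₂ →
      ∀ (η : LGConfig 4 G) (x y : Fin 4 → ℤ) (s₀ : ℝ), 0 < s₀ → s₀ ≤ ‖siteToE (y - x)‖ * u β →
        (n₀ : ℝ) ≤ ‖siteToE (y - x)‖ → K s₀ * ‖siteToE (y - x)‖ ≤ (depth c b x : ℝ) → K s₀ * ‖siteToE (y - x)‖ ≤ (depth c b y : ℝ) →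
          ‖siteToE (y - x)‖ ^ 8 * |kerCov G r β c b η (dens G r x) (dens G r y)| ≤ C₂ * Γ (‖siteToE (y - x)‖ * u β)) :
    CovWindowAt G r (fun β => 1 / u β) :=
  covWindowAt_of_femtoAFAt r hu (femtoAFAt_of_fbl_fc2UpperAF r hu hu0 hFBL hℓ₂ hC₂ hKlim hΓ hFC2U)

end Package

end Summit.QuantumFields.YangMills.Cruxes.IR.AfPincerUc.Femto

end
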